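import Mathlib.LinearAlgebra.QuadraticForm.Prod
import Literature.LinearAlgebra.QuadraticForm.MetabolicSpaces
import HarnessLib

/-!
# Orthogonal sums of metabolic quadratic spaces (Klagsbrun–Mazur–Rubin 2013, proof of Thm. 3.9)

Complements `MetabolicSpaces.lean` (same directory: KMR §2, `IsLagrangian`, `IsMetabolic`,
Lemma 2.2 – Cor. 2.5) with the bookkeeping for finite orthogonal sums
`(⊕ᵢ Vᵢ, ∑ᵢ qᵢ)` = Mathlib's `QuadraticMap.pi`, which is how the metabolic space
`V = ∏_{v ∈ Σ'} H¹(K_v, T)` of the proof of KMR Theorem 3.9 is built ("so `(V, ∑_v q_v)` is a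
metabolic space … The spaces `X = ∏ H¹_ℱ(K_v,T)` and `Y` are Lagrangian by definition of Selmer
structure"), used by `Literature/NumberTheory/EllipticCurves/QuadraticSelmerStructure.lean`.
Theorems only:

* `orthogonal_pi_eq` — for a form `B x y = ∑ᵢ Bᵢ xᵢ yᵢ` on `Π i, Mᵢ`, `(Πᵢ Nᵢ)^⊥ = Πᵢ Nᵢ^⊥`;
  `nondegenerate_of_pi`; `pi_inf_pi`; `finrank_pi_eq_sum` (`dim Πᵢ Nᵢ = ∑ᵢ dim Nᵢ`). [folklore]
* `polarForm_pi_apply` — the polar form of `∑ᵢ qᵢ` is `∑ᵢ (polar form of qᵢ)`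
  (Mathlib `QuadraticMap.Ring.polar_pi`).
* `IsLagrangian.pi`, `IsMetabolic.pi` — products of Lagrangians are Lagrangian, orthogonal sums
  of metabolic spaces are metabolic.
* `finrank_map_add_finrank_inf_ker` — rank–nullity for a linear map restricted to a
  finite-dimensional subspace, `dim f(W) + dim (W ∩ ker f) = dim W` (the dimension count of the
  exact sequences `0 → A → H¹_𝒮(K, T) → X ∩ Z → 0` in the proof of Thm. 3.9). [folklore]

## References

* [KlagsbrunMazurRubin2013] Z. Klagsbrun, B. Mazur, K. Rubin, Disparity in Selmer ranks of
  quadratic twists of elliptic curves, Ann. of Math. (2) 178 (2013), 287–320, proof of Thm. 3.9.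
-/

namespace Literature.LinearAlgebra.QuadraticForm

open Module QuadraticMap

universe u v w

variable {F : Type u} [Field F]

/-! ### Orthogonal sums of bilinear forms -/

section Pi

variable {ι : Type w} [Fintype ι] [DecidableEq ι] {M : ι → Type v}
  [∀ i, AddCommGroup (M i)] [∀ i, Module F (M i)]

/-- For the orthogonal sum form `B x y = ∑ᵢ Bᵢ xᵢ yᵢ` on `Π i, Mᵢ`, the orthogonal complement of a
product of subspaces is the product of the orthogonal complements. [folklore] -/
theorem orthogonal_pi_eq (Bi : ∀ i, LinearMap.BilinForm F (M i))
    (B : LinearMap.BilinForm F (∀ i, M i)) (hB : ∀ x y, B x y = ∑ i, Bi i (x i) (y i))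
    (N : ∀ i, Submodule F (M i)) :
    B.orthogonal (Submodule.pi Set.univ N) =
      Submodule.pi Set.univ fun i => (Bi i).orthogonal (N i) := by
  ext m
  simp only [LinearMap.BilinForm.mem_orthogonal_iff, Submodule.mem_pi, Set.mem_univ, true_imp_iff]
  constructor
  · intro h i n hn
    have h1 := h (Pi.single i n) fun j => by
      rcases eq_or_ne j i with rfl | hj
      · simpa using hn
      · simp [Pi.single_eq_of_ne hj]
    rw [hB, Finset.sum_eq_single i (fun j _ hj => by rw [Pi.single_eq_of_ne hj, map_zero,
      LinearMap.zero_apply]) (fun hi => absurd (Finset.mem_univ i) hi), Pi.single_eq_same] at h1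
    exact h1
  · intro h n hn
    rw [hB]
    exact Finset.sum_eq_zero fun i _ => h i (n i) (hn i)

/-- The orthogonal sum of nondegenerate forms is nondegenerate. [folklore] -/
theorem nondegenerate_of_pi (Bi : ∀ i, LinearMap.BilinForm F (M i))
    (B : LinearMap.BilinForm F (∀ i, M i)) (hB : ∀ x y, B x y = ∑ i, Bi i (x i) (y i))
    (hBi : ∀ i, (Bi i).Nondegenerate) : B.Nondegenerate := by
  have key : ∀ (x : ∀ i, M i) (i : ι) (y : M i), B x (Pi.single i y) = Bi i (x i) y ∧
      B (Pi.single i y) x = Bi i y (x i) := by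
    intro x i y
    constructor
    · rw [hB, Finset.sum_eq_single i (fun j _ hj => by rw [Pi.single_eq_of_ne hj, map_zero])
        (fun hi => absurd (Finset.mem_univ i) hi), Pi.single_eq_same]
    · rw [hB, Finset.sum_eq_single i (fun j _ hj => by rw [Pi.single_eq_of_ne hj, map_zero,
        LinearMap.zero_apply]) (fun hi => absurd (Finset.mem_univ i) hi), Pi.single_eq_same]
  constructor
  · intro x hx
    funext i
    exact (hBi i).1 (x i) fun y => by rw [← (key x i y).1]; exact hx _
  · intro x hx
    funext i
    exact (hBi i).2 (x i) fun y => by rw [← (key x i y).2]; exact hx _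

omit [DecidableEq ι] in
/-- `dim Πᵢ Nᵢ = ∑ᵢ dim Nᵢ` for a product of finite-dimensional subspaces. [folklore] -/
theorem finrank_pi_eq_sum [∀ i, FiniteDimensional F (M i)] (N : ∀ i, Submodule F (M i)) :
    finrank F ↥(Submodule.pi Set.univ N) = ∑ i, finrank F ↥(N i) := by
  let e : ↥(Submodule.pi Set.univ N) ≃ₗ[F] (∀ i, ↥(N i)) :=
    { toFun := fun x i => ⟨(x : ∀ i, M i) i, x.2 i (Set.mem_univ i)⟩
      map_add' := fun _ _ => rfl
      map_smul' := fun _ _ => rfl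
      invFun := fun y => ⟨fun i => (y i : M i), fun i _ => (y i).2⟩
      left_inv := fun _ => rfl
      right_inv := fun _ => rfl }
  rw [LinearEquiv.finrank_eq e, Module.finrank_pi_fintype]

omit [Fintype ι] [DecidableEq ι] in
/-- `(Πᵢ Nᵢ) ∩ (Πᵢ N'ᵢ) = Πᵢ (Nᵢ ∩ N'ᵢ)`. [folklore] -/
theorem pi_inf_pi (N N' : ∀ i, Submodule F (M i)) :
    Submodule.pi Set.univ N ⊓ Submodule.pi Set.univ N' =
      Submodule.pi Set.univ fun i => N i ⊓ N' i := by
  ext x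
  simp only [Submodule.mem_inf, Submodule.mem_pi, Set.mem_univ, true_imp_iff]
  exact ⟨fun h i => ⟨h.1 i, h.2 i⟩, fun h => ⟨fun i => (h i).1, fun i => (h i).2⟩⟩

omit [DecidableEq ι] in
/-- The polar form of `∑ᵢ qᵢ` on `Π i, Mᵢ` is the orthogonal sum of the polar forms
(Mathlib `QuadraticMap.Ring.polar_pi`). [folklore] -/
theorem polarForm_pi_apply (Q : ∀ i, QuadraticForm F (M i)) (x y : ∀ i, M i) :
    polarForm (QuadraticMap.pi Q) x y = ∑ i, polarForm (Q i) (x i) (y i) :=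
  QuadraticMap.Ring.polar_pi Q x y

omit [DecidableEq ι] in
/-- A product of Lagrangian subspaces is Lagrangian for the orthogonal sum `(⊕ᵢ Vᵢ, ∑ᵢ qᵢ)`
(KMR 2013, proof of Thm. 3.9: "The spaces `X` and `Y` are Lagrangian by definition of Selmer
structure"). [cite: KlagsbrunMazurRubin2013, Thm. 3.9 (proof)] -/
theorem IsLagrangian.pi {Q : ∀ i, QuadraticForm F (M i)} {X : ∀ i, Submodule F (M i)}
    (hX : ∀ i, IsLagrangian (Q i) (X i)) :
    IsLagrangian (QuadraticMap.pi Q) (Submodule.pi Set.univ X) := by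
  classical
  refine ⟨?_, fun x hx => ?_⟩
  · rw [orthogonal_pi_eq (fun i => polarForm (Q i)) (polarForm (QuadraticMap.pi Q))
      (polarForm_pi_apply Q) X]
    exact congrArg (Submodule.pi Set.univ) (funext fun i => (hX i).orthogonal_eq)
  · rw [QuadraticMap.pi_apply]
    exact Finset.sum_eq_zero fun i _ => (hX i).isTotallyIsotropic _ (hx i (Set.mem_univ i))

omit [DecidableEq ι] in
/-- An orthogonal sum of metabolic spaces is metabolic (KMR 2013, proof of Thm. 3.9:
"`V = ∏_{v ∈ Σ'} H¹(K_v, T)`, so `(V, ∑_v q_v)` is a metabolic space").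
[cite: KlagsbrunMazurRubin2013, Thm. 3.9 (proof)] -/
theorem IsMetabolic.pi {Q : ∀ i, QuadraticForm F (M i)} (hQ : ∀ i, IsMetabolic (Q i)) :
    IsMetabolic (QuadraticMap.pi Q) := by
  classical
  refine ⟨nondegenerate_of_pi (fun i => polarForm (Q i)) (polarForm (QuadraticMap.pi Q))
    (polarForm_pi_apply Q) fun i => (hQ i).1, ?_⟩
  choose X hX using fun i => (hQ i).2
  exact ⟨Submodule.pi Set.univ X, IsLagrangian.pi hX⟩

end Pi

/-! ### Rank–nullity on a subspace -/

/-- Rank–nullity for the restriction of a linear map `f` to a finite-dimensional subspace `W`: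
`dim f(W) + dim (W ∩ ker f) = dim W`. [folklore] -/
theorem finrank_map_add_finrank_inf_ker {V : Type v} [AddCommGroup V] [Module F V]
    {M : Type w} [AddCommGroup M] [Module F M]
    (f : V →ₗ[F] M) (W : Submodule F V) [FiniteDimensional F W] :
    finrank F ↥(W.map f) + finrank F ↥(W ⊓ LinearMap.ker f) = finrank F W := by
  have h := LinearMap.finrank_range_add_finrank_ker (f.domRestrict W)
  rw [LinearMap.range_domRestrict, LinearMap.ker_domRestrict, ← Submodule.finrank_map_subtype_eq
    W (Submodule.comap W.subtype (LinearMap.ker f)), Submodule.map_comap_subtype] at h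
  exact h

end Literature.LinearAlgebra.QuadraticForm
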